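import Mathlib.Data.List.Basic
import HarnessLib

/-!
# A positional binary tree for kernel replays: `O(log n)` random access into a long literal list, CORRECT BY A THEOREM
# (`PTree.lookup_build : lookup D (build D l).1 l i d = l.getD i d`), so list-indexed definitions get tree-backed twins with unchanged
# semantics

HONEST FRAMING: Lean plumbing towards «tier P» (cell hubbard-obs; answer to hubbard-cov-la214-box-1 g3's DATA «KERNEL-COST PROBE OF THE
GRAM-TABLE CHECKS ON REAL Rm2 DATA», HOME/STATUS 2026-08-29T00:34:47Z): in the kernel a positional read `l.getD i d` of a literal list walks
`i` cons cells (measured ≈ 44 µs per cell on the farm, and the cached intermediates trip the kernel's memory guard near 2·10⁶ cells per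
declaration); the contracted-Gram word table of an Rm2 certificate has `W ≈ 2 600` rows read ≈ 10³–10⁴ times per declaration. Here:
`PTree β` (nil / leaf / node), `PTree.build D l` = the perfect tree of depth `D` over the first `2^D` entries of `l` (structural in `D`,
built by the kernel ONCE per declaration — the term `build D l` is closed and shared, so its evaluation is cached), `PTree.get? t D i`
(walks `D` nodes, one `Nat` comparison and one subtraction each), the unconditional read `PTree.lookup D t l i d` (falls back to the list
beyond `2^D`, so NO length hypothesis), and the two theorems `get?_build` / **`lookup_build`**. Generic; no physics; nothing of record;
no summit statement is proved by this file. Seat hubbard-obs-p2 (STIFFNESS), `prover-hubbard-obs-p2-g24-0`, zero compute.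

References: C. Okasaki, *Purely Functional Data Structures* (CUP 1998) §9.2 (positional/binary random-access structures) [Okasaki1998];
C. Jansson, D. Chaykin, C. Keil, SIAM J. Numer. Anal. 46 (2008) 180 (rigorous replay of SDP certificates — the consumer) [JanssonChaykinKeil2008].
-/

namespace Summit.Ventures.CertifiedManyBodySolver

namespace CARPolyWindow

/-- A positional binary tree: empty, a leaf holding one entry, or a node with two subtrees. [cite: Okasaki1998, §9.2] -/
inductive PTree (β : Type*) where
  /-- no entry -/
  | nil : PTree β
  /-- one entry -/
  | leaf : β → PTree β
  /-- two subtrees (left = lower indices) -/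
  | node : PTree β → PTree β → PTree β

namespace PTree

variable {β : Type*}

/-- **Build** the perfect tree of depth `D` over the first `2^D` entries of `l`, returning the unused tail. Structural in `D`.
[cite: Okasaki1998, §9.2] -/
def build : ℕ → List β → PTree β × List β
  | 0, [] => (nil, [])
  | 0, b :: l => (leaf b, l)
  | D + 1, l =>
    let p := build D l
    let q := build D p.2
    (node p.1 q.1, q.2)

/-- **Read** entry `i` of a depth-`D` tree (`none` if absent): `D` node steps. [cite: Okasaki1998, §9.2] -/
def get? : PTree β → ℕ → ℕ → Option β
  | nil, _, _ => none
  | leaf b, _, i => if i = 0 then some b else none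
  | node _ _, 0, _ => none
  | node t₁ t₂, D + 1, i => if i < 2 ^ D then get? t₁ D i else get? t₂ D (i - 2 ^ D)

/-- The unused tail of `build D l` is `l.drop (2^D)`. [folklore] -/
theorem build_snd : ∀ (D : ℕ) (l : List β), (build D l).2 = l.drop (2 ^ D)
  | 0, [] => rfl
  | 0, _ :: _ => rfl
  | D + 1, l => by
    show (build D (build D l).2).2 = l.drop (2 ^ (D + 1))
    rw [build_snd D, build_snd D, List.drop_drop, ← Nat.two_pow_succ]

/-- **`build` is read back by `get?`**: entry `i` of the built tree is `l[i]?` for `i < 2^D` and `none` beyond — for EVERY `l`. [folklore] -/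
theorem get?_build : ∀ (D : ℕ) (l : List β) (i : ℕ), (build D l).1.get? D i = if i < 2 ^ D then l[i]? else none
  | 0, [], i => by simp [build, get?]
  | 0, b :: l, i => by
    cases i with
    | zero => simp [build, get?]
    | succ i => simp [build, get?]
  | D + 1, l, i => by
    show get? (node (build D l).1 (build D (build D l).2).1) (D + 1) i = _
    rw [get?, get?_build D l i, get?_build D (build D l).2 (i - 2 ^ D), build_snd D l, List.getElem?_drop]
    have h2 : 2 ^ (D + 1) = 2 ^ D + 2 ^ D := Nat.two_pow_succ D
    by_cases hi : i < 2 ^ D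
    · rw [if_pos hi, if_pos hi, if_pos (by omega)]
    · rw [if_neg hi]
      by_cases hj : i - 2 ^ D < 2 ^ D
      · rw [if_pos hj, if_pos (by omega), Nat.add_sub_cancel' (Nat.le_of_not_lt hi)]
      · rw [if_neg hj, if_neg (by omega)]

/-- **The unconditional read**: through the tree below `2^D`, through the list beyond (never taken when `D` is adequate). [folklore] -/
def lookup (D : ℕ) (t : PTree β) (l : List β) (i : ℕ) (d : β) : β := if i < 2 ^ D then (t.get? D i).getD d else l.getD i d

/-- **`lookup` through the built tree IS the positional list read** — no hypothesis on `D` or on the length of `l`. [folklore] -/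
theorem lookup_build (D : ℕ) (l : List β) (i : ℕ) (d : β) : lookup D (build D l).1 l i d = l.getD i d := by
  unfold lookup
  rw [get?_build]
  split_ifs with h
  · rw [List.getD_eq_getElem?_getD]
  · rfl

/-- The depth an instance should pass: the least `D` with `n ≤ 2^D` (a convenience for exporters; any `D` is sound). [folklore] -/
def depthFor (n : ℕ) : ℕ := if n ≤ 1 then 0 else Nat.log2 (n - 1) + 1

end PTree

end CARPolyWindow

end Summit.Ventures.CertifiedManyBodySolver
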